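import Literature.Barriers.CriticalPhenomena.WeaklySAWFiniteVolumeRenormalised
import Literature.Barriers.CriticalPhenomena.WeaklySAWFourDimLogCorrectionsCesaroAssembly
import HarnessLib

/-!
# BBS 2015, §8.4 as printed: Theorem 4.1 read off the finite-volume identity
# `χ̂_N = m⁻² + m⁻⁴(-ν_N + |Λ|⁻¹D²W_N⁰ + |Λ|⁻¹D²K_N⁰)`, its `ν₀`-derivative, and Lemmas 8.3.2–8.3.3

Companion of `WeaklySAWFiniteVolumeRenormalised.lean` (the finite-volume renormalised
susceptibility `χ̂_N = chiHatN` and the two read-off lemmas `criticalNu_lt_and_chiHat_eq_of_tendsto`,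
`deriv_chiHat_eq_of_tendsto`) and of `WeaklySAWFourDimLogCorrectionsReduction.lean` (`Thm41Data`,
the content of Theorem 4.1, and the named fact `BBS2015_thm41`). Source: R. Bauerschmidt,
D. C. Brydges, G. Slade, *Logarithmic correction for the susceptibility of the 4-dimensional weakly
self-avoiding walk: a renormalisation group analysis*, CMP **337** (2015), arXiv:1403.7422, §8.4
"Proof of Theorem 4.1":

"Let `ν₀ᶜ = μ₀ᶜ` and `z₀ᶜ` be the functions of Proposition [flow-flow], which as desired are
continuous in `(m²,g₀)` and differentiable in `g₀`. … it suffices to show that for `χ̂` and `χ̂'`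
evaluated at `(m²,g₀,ν₀ᶜ,z₀ᶜ)`, `χ̂ = 1/m²`, `χ̂' ∼ -(1/m⁴) c(ĝ₀)/(ĝ₀𝖡_{m²})^γ` as
`(m²,g₀) → (0,ĝ₀)`, with `c` continuous and `c(g₀) = 1 + O(g₀)`. We do this using the identity
[chibarm-bis2], which asserts that `χ̂_N = 1/m² + (1/m⁴)(-ν_N + |Λ|⁻¹D²W_N⁰(0,0;1,1) +
|Λ|⁻¹D²K_N⁰(0,0;1,1))` … this allows the identity to be differentiated in `V₀` at `V₀ = V₀ᶜ`.
… `ν_j = L^{-2j}μ_j`, so Proposition [flow-flow] implies `ν_N = O(χ_Nḡ_NL^{-2N}) → 0`. We prove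
`χ̂ = m⁻²` by showing that the `W` and `K` terms … are even smaller … For `χ̂'`, by [nupinf]
(`lim_N ν_N' = c(m²,g₀)(ǧ_∞/g₀)^γ ∼ c(ĝ₀)/(ĝ₀𝖡_{m²})^γ`), the leading term `-m⁻⁴ν_N'` obeys
the asymptotic formula desired for `χ̂'` … the `ν₀`-derivative [of the `W` term] is bounded by
`O(χ_Nḡ_NL^{-2N}μ_N') = O(χ_Nḡ_Nν_N')`, so it is smaller than the leading contribution `ν_N'` by
a factor `O(χ_Nḡ_N) → 0` … the contribution due to `K` is also small relative to the contributions
due to `ν`, and the proof is complete."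

## What this file does

It PROVES this read-off: the hypothesis structure **`CTWSAW.Sec84Data δ K L ν₀c z₀c c ǧ∞`**
packages exactly the renormalisation-group OUTPUTS the printed argument invokes —

* Proposition [flow-flow] (= Prop. 8.2): `ν₀ᶜ = μ₀ᶜ, z₀ᶜ` continuous on `[0,δ)²`, differentiable
  in `g₀`, vanishing at `g₀ = 0`, `∂/∂g₀ = O(1)`;
* Lemma 8.3.3: `c : [0,δ)² → ℝ` continuous with `c(m²,g₀) = 1 + O(g₀)`;
* Lemma 8.3.2, (e:ginfty): `ǧ_∞ ∼ 1/𝖡_{m²}` as `(m²,g₀) → (0,ĝ₀)`;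
* the identity [chibarm-bis3] for `N` large (`m² ≥ δL^{-2(N-1)}`) with the three printed bounds
  `ν_N = L^{-2N}μ_N`, `μ_N` bounded, `W`-term and `K`-term `O(L^{-2N})`;
* its `ν₀`-derivative at `ν₀ᶜ`, `χ̂_N' = m⁻⁴(-ν_N' + W' + K')` with `ν_N' = L^{-2N}μ_N'`,
  `|W'|, |K'| ≤ O(χ_N)|ν_N'|`, `χ_N → 0` (`m² > 0`), and [nupinf]: `ν_N' → c(m²,g₀)(ǧ_∞/g₀)^γ`

— and **`Sec84Data.thm41Data : Thm41Data δ K ν₀c z₀c (c(0,·))`** is Theorem 4.1 with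
`c(ĝ₀) = c(0,ĝ₀)` ("setting `c(ĝ₀) = c(0,ĝ₀)`"), hence `BBS2015_thm41` and Theorem 1.1
(`BBS2015_thm41_of_sec84Data`, `BBS2015_thm11_of_sec84Data`). On the way: `z₀ᶜ = O(g₀)` hence
`z₀ᶜ > -1` (mean value theorem from the printed `z₀ᶜ(m²,0) = 0`, `∂z₀ᶜ/∂g₀ = O(1)`), `χ̂_N → m⁻²`
(`tendsto_chiHatN`) hence `ν > ν_c` and `χ̂ = m⁻²` (`chiHat_eq`), `∂χ̂_N/∂ν₀ → -m⁻⁴c(ǧ_∞/g₀)^γ`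
(`tendsto_deriv_chiHatN`) hence `∂χ̂/∂ν₀ = -m⁻⁴c(m²,g₀)(ǧ_∞/g₀)^γ` (`deriv_chiHat_eq`), and the
asymptotic ratio `→ 1` (`chiHat_deriv_asymp`: continuity of `c`, `ǧ_∞𝖡_{m²} → 1`, `g₀ → ĝ₀`).

Everything here is proved; no definition and no named fact is introduced (the structure is a
`Prop`-valued hypothesis record, consumed — like `Thm41Data` — by whoever supplies the RG output).

Locators: §8.4 by section, displays by content (display numbers are not legible in the held text).
-/

noncomputable section

open MeasureTheory Filter Topology Set
open Literature.Probability.LatticeModels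
open scoped BigOperators

namespace Literature.Barriers.CriticalPhenomena

namespace CTWSAW

/-! ### Two elementary lemmas -/

/-- `𝖡_{m²} ≥ 0` (an integral of a square). [cite: BauerschmidtBrydgesSlade2015LogCorr, eq. (1.8)] -/
theorem freeBubble_nonneg (d : ℕ) (m2 : ℝ) : 0 ≤ freeBubble d m2 := by
  unfold freeBubble
  have : 0 ≤ ∫ k in brillouin d, |1 / (4 * ∑ j, Real.sin (k j / 2) ^ 2 + m2)| ^ 2 :=
    integral_nonneg fun k => by positivity
  positivity

/-- Mean-value estimate from the right end-point: `f` right-continuous at `0` (within `[0,δ)`),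
differentiable on `(0,δ)` with `|f'| ≤ K` there, gives `|f(g₀) - f(0)| ≤ Kg₀` on `(0,δ)` — how
`z₀ᶜ(m²,0) = 0`, `∂z₀ᶜ/∂g₀ = O(1)` give `z₀ᶜ = O(g₀)`. [folklore] -/
theorem abs_sub_le_of_abs_deriv_le {f : ℝ → ℝ} {δ K g₀ : ℝ}
    (hcont : ContinuousWithinAt f (Ico 0 δ) 0) (hdiff : DifferentiableOn ℝ f (Ioo 0 δ))
    (hK : ∀ x ∈ Ioo 0 δ, |deriv f x| ≤ K) (hg : g₀ ∈ Ioo 0 δ) : |f g₀ - f 0| ≤ K * g₀ := by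
  have hδ : 0 < δ := hg.1.trans hg.2
  have hmvt : ∀ ε ∈ Ioo 0 g₀, |f g₀ - f ε| ≤ K * g₀ := by
    intro ε hε
    have hεs : ε ∈ Ioo 0 δ := ⟨hε.1, hε.2.trans hg.2⟩
    have hK0 : 0 ≤ K := (abs_nonneg _).trans (hK ε hεs)
    have h := (convex_Ioo 0 δ).norm_image_sub_le_of_norm_deriv_le
      (fun x hx => hdiff.differentiableAt (Ioo_mem_nhds hx.1 hx.2))
      (fun x hx => by rw [Real.norm_eq_abs]; exact hK x hx) hεs hg
    rw [Real.norm_eq_abs, Real.norm_eq_abs, abs_of_pos (by linarith [hε.2] : 0 < g₀ - ε)] at h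
    refine h.trans ?_
    nlinarith [hε.1]
  have hlim : Tendsto f (𝓝[>] 0) (𝓝 (f 0)) := by
    have := (hcont.mono Ioo_subset_Ico_self).tendsto
    rwa [nhdsWithin_Ioo_eq_nhdsGT hδ] at this
  have hlim' : Tendsto (fun ε => |f g₀ - f ε|) (𝓝[>] 0) (𝓝 |f g₀ - f 0|) :=
    (continuous_abs.tendsto _).comp (tendsto_const_nhds.sub hlim)
  refine le_of_tendsto hlim' ?_
  filter_upwards [Ioo_mem_nhdsGT hg.1] with ε hε using hmvt ε hε

/-! ### The hypothesis structure of §8.4 -/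

/-- **The renormalisation-group outputs from which §8.4 reads off Theorem 4.1** (`d = 4`,
`γ = ¼`, torus `Λ_N` of period `Lᴺ`), for functions `ν₀ᶜ, z₀ᶜ, c, ǧ_∞ : (m²,g₀) ↦ ℝ`:
* `pos`, `two_le` — `δ > 0`, `L ≥ 2` (Theorem 4.1's "`δ` sufficiently small" is then DERIVED:
  the structure restricts to any smaller `δ' > 0`, `Sec84Data.restrict`, and the read-off below is
  run at a `δ' ≤ δ` with `Kδ' ≤ ½`);
* Proposition 8.2 [flow-flow]: `ν₀ᶜ = μ₀ᶜ`, `z₀ᶜ` continuous on `[0,δ)²`, differentiable in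
  `g₀ ∈ (0,δ)`, `ν₀ᶜ(m²,0) = z₀ᶜ(m²,0) = 0`, `|∂ν₀ᶜ/∂g₀|, |∂z₀ᶜ/∂g₀| ≤ K`
  (`cont_ν₀c … deriv_z₀c`);
* Lemma 8.3.3: `c` continuous on `[0,δ)²` with `|c(m²,g₀) - 1| ≤ Kg₀` (`cont_c`, `c_sub_one`);
* Lemma 8.3.2, (e:ginfty): `ǧ_∞𝖡_{m²} → 1` as `(m²,g₀) → (0,ĝ₀)` in `(0,δ)²` (`gInf_asymp`);
* (e:chibarm-bis3) with its bounds (`identity`): for `m², g₀ ∈ (0,δ)` there are sequences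
  `μ_N` (bounded: "`ν_N = L^{-2N}μ_N`, … `μ_N = O(χ_Nḡ_N)`"), `w_N, k_N = O(L^{-2N})` (the `W`- and
  `K`-terms, "`≤ O(χ_Nḡ_N²L^{-2N})`") with, for all large `N`,
  `χ̂_N(m²,g₀,ν₀ᶜ,z₀ᶜ) = m⁻² + m⁻⁴(-L^{-2N}μ_N + w_N + k_N)`;
* its `ν₀`-derivative (`identity_deriv`): sequences `μ_N'`, `w_N'`, `k_N'`, `χ_N` with `χ_N → 0`,
  `|w_N'|, |k_N'| ≤ Mχ_N|L^{-2N}μ_N'|` ("smaller than the leading contribution `ν_N'` by a factor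
  `O(χ_Nḡ_N) → 0`"), [nupinf] `L^{-2N}μ_N' → c(m²,g₀)(ǧ_∞/g₀)^{1/4}`, and, for all large `N`,
  `∂χ̂_N/∂ν₀|_{ν₀ᶜ} = m⁻⁴(-L^{-2N}μ_N' + w_N' + k_N')`.
[cite: BauerschmidtBrydgesSlade2015LogCorr, §8.4 (Proof of Theorem 4.1), with Proposition 8.2, Lemma 8.3.2 (e:ginfty), Lemma 8.3.3 and display (nupinf)] -/
structure Sec84Data (δ K : ℝ) (L : ℕ) (ν₀c z₀c cfn gInf : ℝ → ℝ → ℝ) : Prop where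
  /-- `δ > 0`. -/
  pos : 0 < δ
  /-- `L ≥ 2`. -/
  two_le : 2 ≤ L
  /-- `ν₀ᶜ` continuous on `[0,δ)²`. -/
  cont_ν₀c : ContinuousOn (fun p : ℝ × ℝ => ν₀c p.1 p.2) (Ico 0 δ ×ˢ Ico 0 δ)
  /-- `z₀ᶜ` continuous on `[0,δ)²`. -/
  cont_z₀c : ContinuousOn (fun p : ℝ × ℝ => z₀c p.1 p.2) (Ico 0 δ ×ˢ Ico 0 δ)
  /-- `ν₀ᶜ(m²,·)` differentiable on `(0,δ)`. -/
  diff_ν₀c : ∀ m2 ∈ Ico (0 : ℝ) δ, DifferentiableOn ℝ (ν₀c m2) (Ioo 0 δ)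
  /-- `z₀ᶜ(m²,·)` differentiable on `(0,δ)`. -/
  diff_z₀c : ∀ m2 ∈ Ico (0 : ℝ) δ, DifferentiableOn ℝ (z₀c m2) (Ioo 0 δ)
  /-- `ν₀ᶜ(m²,0) = 0`. -/
  ν₀c_zero : ∀ m2 ∈ Ico (0 : ℝ) δ, ν₀c m2 0 = 0
  /-- `z₀ᶜ(m²,0) = 0`. -/
  z₀c_zero : ∀ m2 ∈ Ico (0 : ℝ) δ, z₀c m2 0 = 0
  /-- `|∂ν₀ᶜ/∂g₀| ≤ K`. -/
  deriv_ν₀c : ∀ m2 ∈ Ico (0 : ℝ) δ, ∀ g₀ ∈ Ioo (0 : ℝ) δ, |deriv (ν₀c m2) g₀| ≤ K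
  /-- `|∂z₀ᶜ/∂g₀| ≤ K`. -/
  deriv_z₀c : ∀ m2 ∈ Ico (0 : ℝ) δ, ∀ g₀ ∈ Ioo (0 : ℝ) δ, |deriv (z₀c m2) g₀| ≤ K
  /-- Lemma 8.3.3: `c` continuous on `[0,δ)²`. -/
  cont_c : ContinuousOn (fun p : ℝ × ℝ => cfn p.1 p.2) (Ico 0 δ ×ˢ Ico 0 δ)
  /-- Lemma 8.3.3: `c(m²,g₀) = 1 + O(g₀)`. -/
  c_sub_one : ∀ m2 ∈ Ico (0 : ℝ) δ, ∀ g₀ ∈ Ioo (0 : ℝ) δ, |cfn m2 g₀ - 1| ≤ K * g₀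
  /-- Lemma 8.3.2, (e:ginfty): `ǧ_∞ ∼ 1/𝖡_{m²}` as `(m²,g₀) → (0,ĝ₀)`. -/
  gInf_asymp : ∀ ĝ₀ ∈ Ioo (0 : ℝ) δ,
    Tendsto (fun p : ℝ × ℝ => gInf p.1 p.2 * freeBubble 4 p.1)
      (𝓝[Ioo 0 δ ×ˢ Ioo 0 δ] (0, ĝ₀)) (𝓝 1)
  /-- (e:chibarm-bis3) with the bounds on `ν_N = L^{-2N}μ_N`, the `W`-term and the `K`-term. -/
  identity : ∀ m2 ∈ Ioo (0 : ℝ) δ, ∀ g₀ ∈ Ioo (0 : ℝ) δ, ∃ (μ w k : ℕ → ℝ) (M : ℝ),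
    (∀ N, |μ N| ≤ M) ∧ (∀ N, |w N| ≤ M / (L : ℝ) ^ (2 * N)) ∧
    (∀ N, |k N| ≤ M / (L : ℝ) ^ (2 * N)) ∧
    ∀ᶠ N : ℕ in atTop, chiHatN 4 (L ^ N) m2 g₀ (ν₀c m2 g₀) (z₀c m2 g₀) =
      1 / m2 + 1 / m2 ^ 2 * (-(μ N / (L : ℝ) ^ (2 * N)) + w N + k N)
  /-- The `ν₀`-derivative of (e:chibarm-bis3) at `ν₀ᶜ`, with `|W'|, |K'| ≤ O(χ_N)|ν_N'|`, `χ_N → 0`,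
  and [nupinf] `ν_N' = L^{-2N}μ_N' → c(m²,g₀)(ǧ_∞/g₀)^{1/4}` (Lemmas 8.3.2–8.3.3). -/
  identity_deriv : ∀ m2 ∈ Ioo (0 : ℝ) δ, ∀ g₀ ∈ Ioo (0 : ℝ) δ, ∃ (dμ dw dk χ : ℕ → ℝ) (M : ℝ),
    Tendsto χ atTop (𝓝 0) ∧
    (∀ N, |dw N| ≤ M * χ N * |dμ N / (L : ℝ) ^ (2 * N)|) ∧
    (∀ N, |dk N| ≤ M * χ N * |dμ N / (L : ℝ) ^ (2 * N)|) ∧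
    Tendsto (fun N => dμ N / (L : ℝ) ^ (2 * N)) atTop
      (𝓝 (cfn m2 g₀ * (gInf m2 g₀ / g₀) ^ (1 / 4 : ℝ))) ∧
    ∀ᶠ N : ℕ in atTop, HasDerivAt (fun ν₀ => chiHatN 4 (L ^ N) m2 g₀ ν₀ (z₀c m2 g₀))
      (1 / m2 ^ 2 * (-(dμ N / (L : ℝ) ^ (2 * N)) + dw N + dk N)) (ν₀c m2 g₀)

namespace Sec84Data

variable {δ K : ℝ} {L : ℕ} {ν₀c z₀c cfn gInf : ℝ → ℝ → ℝ}
variable (h : Sec84Data δ K L ν₀c z₀c cfn gInf)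
include h

/-- `K ≥ 0`. [folklore] -/
theorem K_nonneg : 0 ≤ K :=
  (abs_nonneg _).trans
    (h.deriv_z₀c 0 ⟨le_rfl, h.pos⟩ (δ / 2) ⟨by linarith [h.pos], by linarith [h.pos]⟩)

/-- Restriction to a smaller `δ' ∈ (0,δ]` ("`δ` sufficiently small"). [folklore] -/
theorem restrict {δ' : ℝ} (hδ' : 0 < δ') (hle : δ' ≤ δ) : Sec84Data δ' K L ν₀c z₀c cfn gInf := by
  have hc : Ico (0 : ℝ) δ' ⊆ Ico 0 δ := Ico_subset_Ico_right hle
  have ho : Ioo (0 : ℝ) δ' ⊆ Ioo 0 δ := Ioo_subset_Ioo_right hle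
  have hcc : Ico (0 : ℝ) δ' ×ˢ Ico (0 : ℝ) δ' ⊆ Ico 0 δ ×ˢ Ico 0 δ := prod_mono hc hc
  have hoo : Ioo (0 : ℝ) δ' ×ˢ Ioo (0 : ℝ) δ' ⊆ Ioo 0 δ ×ˢ Ioo 0 δ := prod_mono ho ho
  exact
    { pos := hδ'
      two_le := h.two_le
      cont_ν₀c := h.cont_ν₀c.mono hcc
      cont_z₀c := h.cont_z₀c.mono hcc
      diff_ν₀c := fun m2 hm2 => (h.diff_ν₀c m2 (hc hm2)).mono ho
      diff_z₀c := fun m2 hm2 => (h.diff_z₀c m2 (hc hm2)).mono ho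
      ν₀c_zero := fun m2 hm2 => h.ν₀c_zero m2 (hc hm2)
      z₀c_zero := fun m2 hm2 => h.z₀c_zero m2 (hc hm2)
      deriv_ν₀c := fun m2 hm2 g₀ hg₀ => h.deriv_ν₀c m2 (hc hm2) g₀ (ho hg₀)
      deriv_z₀c := fun m2 hm2 g₀ hg₀ => h.deriv_z₀c m2 (hc hm2) g₀ (ho hg₀)
      cont_c := h.cont_c.mono hcc
      c_sub_one := fun m2 hm2 g₀ hg₀ => h.c_sub_one m2 (hc hm2) g₀ (ho hg₀)
      gInf_asymp := fun ĝ₀ hĝ₀ =>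
        (h.gInf_asymp ĝ₀ (ho hĝ₀)).mono_left (nhdsWithin_mono _ hoo)
      identity := fun m2 hm2 g₀ hg₀ => h.identity m2 (ho hm2) g₀ (ho hg₀)
      identity_deriv := fun m2 hm2 g₀ hg₀ => h.identity_deriv m2 (ho hm2) g₀ (ho hg₀) }

/-- `L^{-2N} → 0`, quantitatively `M/L^{2N} → 0`. [folklore] -/
theorem tendsto_const_div_pow (M : ℝ) :
    Tendsto (fun N : ℕ => M / (L : ℝ) ^ (2 * N)) atTop (𝓝 0) := by
  have hL : (1 : ℝ) < (L : ℝ) ^ 2 := by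
    have : (2 : ℝ) ≤ L := by exact_mod_cast h.two_le
    nlinarith
  have hpow : Tendsto (fun N : ℕ => (L : ℝ) ^ (2 * N)) atTop atTop := by
    simp_rw [pow_mul]
    exact tendsto_pow_atTop_atTop_of_one_lt hL
  exact tendsto_const_nhds.div_atTop hpow

/-- **`z₀ᶜ = O(g₀)`**: `|z₀ᶜ(m²,g₀)| ≤ Kg₀` on `[0,δ) × (0,δ)` (from `z₀ᶜ(m²,0) = 0` and
`∂z₀ᶜ/∂g₀ = O(1)`). [cite: BauerschmidtBrydgesSlade2015LogCorr, Theorem 4.1 (z₀ᶜ(m²,0) = 0, ∂z₀ᶜ/∂g₀ = O(1))] -/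
theorem abs_z₀c_le {m2 : ℝ} (hm2 : m2 ∈ Ico (0 : ℝ) δ) {g₀ : ℝ} (hg₀ : g₀ ∈ Ioo (0 : ℝ) δ) :
    |z₀c m2 g₀| ≤ K * g₀ := by
  have hcont : ContinuousWithinAt (z₀c m2) (Ico 0 δ) 0 := by
    have h0 : ((m2, (0 : ℝ)) : ℝ × ℝ) ∈ Ico 0 δ ×ˢ Ico 0 δ := ⟨hm2, ⟨le_rfl, h.pos⟩⟩
    have hc := h.cont_z₀c (m2, 0) h0
    have hf : ContinuousWithinAt (fun g : ℝ => ((m2, g) : ℝ × ℝ)) (Ico 0 δ) 0 :=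
      (continuous_const.prodMk continuous_id).continuousWithinAt
    exact ContinuousWithinAt.comp (f := fun g : ℝ => ((m2, g) : ℝ × ℝ)) hc hf
      (fun g hg => ⟨hm2, hg⟩)
  have := abs_sub_le_of_abs_deriv_le hcont (h.diff_z₀c m2 hm2) (h.deriv_z₀c m2 hm2) hg₀
  rwa [h.z₀c_zero m2 hm2, sub_zero] at this

/-- `z₀ᶜ > -1` on `[0,δ) × (0,δ)` when `Kδ ≤ ½` (`|z₀ᶜ| ≤ Kg₀ < Kδ ≤ ½`), so that
`χ = (1+z₀ᶜ)χ̂` is available.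
[cite: BauerschmidtBrydgesSlade2015LogCorr, §4.1 and Theorem 4.1 (δ sufficiently small)] -/
theorem neg_one_lt_z₀c (hs : K * δ ≤ 1 / 2) {m2 : ℝ} (hm2 : m2 ∈ Ico (0 : ℝ) δ) {g₀ : ℝ}
    (hg₀ : g₀ ∈ Ioo (0 : ℝ) δ) : -1 < z₀c m2 g₀ := by
  have h1 := h.abs_z₀c_le hm2 hg₀
  have h2 : K * g₀ ≤ K * δ := mul_le_mul_of_nonneg_left hg₀.2.le h.K_nonneg
  have := neg_abs_le (z₀c m2 g₀)
  linarith

/-- **`χ̂_N → m⁻²`**: the three correction terms of (e:chibarm-bis3) vanish as `N → ∞`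
("`ν_N = O(χ_Nḡ_NL^{-2N}) → 0`", the `W` and `K` terms "are even smaller").
[cite: BauerschmidtBrydgesSlade2015LogCorr, §8.4 (proof of χ̂ = m⁻²)] -/
theorem tendsto_chiHatN {m2 : ℝ} (hm2 : m2 ∈ Ioo (0 : ℝ) δ) {g₀ : ℝ} (hg₀ : g₀ ∈ Ioo (0 : ℝ) δ) :
    Tendsto (fun N : ℕ => chiHatN 4 (L ^ N) m2 g₀ (ν₀c m2 g₀) (z₀c m2 g₀)) atTop (𝓝 (1 / m2)) := by
  obtain ⟨μ, w, k, M, hμ, hw, hk, hev⟩ := h.identity m2 hm2 g₀ hg₀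
  have hL0 : (0 : ℝ) < L := by exact_mod_cast (lt_of_lt_of_le (by norm_num) h.two_le : 0 < L)
  have h0 := h.tendsto_const_div_pow M
  have hbound : ∀ (u : ℕ → ℝ), (∀ N, |u N| ≤ M / (L : ℝ) ^ (2 * N)) →
      Tendsto u atTop (𝓝 0) := fun u hu =>
    squeeze_zero_norm (fun N => by rw [Real.norm_eq_abs]; exact hu N) h0
  have hμ0 : Tendsto (fun N => μ N / (L : ℝ) ^ (2 * N)) atTop (𝓝 0) := by
    refine hbound _ fun N => ?_
    rw [abs_div, abs_of_pos (pow_pos hL0 _)]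
    exact div_le_div_of_nonneg_right (hμ N) (pow_pos hL0 _).le
  have hw0 : Tendsto w atTop (𝓝 0) := hbound w hw
  have hk0 : Tendsto k atTop (𝓝 0) := hbound k hk
  have hlim : Tendsto (fun N => 1 / m2 + 1 / m2 ^ 2 * (-(μ N / (L : ℝ) ^ (2 * N)) + w N + k N))
      atTop (𝓝 (1 / m2)) := by
    have := (((hμ0.neg.add hw0).add hk0).const_mul (1 / m2 ^ 2)).const_add (1 / m2)
    simpa using this
  exact hlim.congr' (hev.mono fun N hN => hN.symm)

/-- **`ν > ν_c` and `χ̂ = m⁻²`** at `(m²,g₀,ν₀ᶜ,z₀ᶜ)`, `m², g₀ ∈ (0,δ)` — the first display of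
Theorem 4.1, read off `χ̂_N → m⁻²` through Lemma 2.1 (`criticalNu_lt_and_chiHat_eq_of_tendsto`).
[cite: BauerschmidtBrydgesSlade2015LogCorr, §8.4 (proof of χ̂ = m⁻²) with §4.1 (χ̂ = lim χ̂_N)] -/
theorem criticalNu_lt_and_chiHat_eq (hs : K * δ ≤ 1 / 2) {m2 : ℝ} (hm2 : m2 ∈ Ioo (0 : ℝ) δ)
    {g₀ : ℝ} (hg₀ : g₀ ∈ Ioo (0 : ℝ) δ) :
    criticalNu 4 (g₀ / (1 + z₀c m2 g₀) ^ 2) < (ν₀c m2 g₀ + m2) / (1 + z₀c m2 g₀) ∧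
      chiHat 4 m2 g₀ (ν₀c m2 g₀) (z₀c m2 g₀) = 1 / m2 :=
  criticalNu_lt_and_chiHat_eq_of_tendsto (d := 4) (by norm_num) h.two_le hg₀.1 m2 (ν₀c m2 g₀)
    (h.neg_one_lt_z₀c hs (Ioo_subset_Ico_self hm2) hg₀) (h.tendsto_chiHatN hm2 hg₀)

/-- **`∂χ̂_N/∂ν₀ → -m⁻⁴c(m²,g₀)(ǧ_∞/g₀)^γ`**: the leading term `-m⁻⁴ν_N'` converges by [nupinf]
and the `W'`, `K'` terms are `O(χ_N)ν_N' → 0`.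
[cite: BauerschmidtBrydgesSlade2015LogCorr, §8.4 (proof of the asymptotics of χ̂') and display (nupinf)] -/
theorem tendsto_deriv_chiHatN {m2 : ℝ} (hm2 : m2 ∈ Ioo (0 : ℝ) δ) {g₀ : ℝ}
    (hg₀ : g₀ ∈ Ioo (0 : ℝ) δ) :
    Tendsto (fun N : ℕ => deriv (fun ν₀ => chiHatN 4 (L ^ N) m2 g₀ ν₀ (z₀c m2 g₀)) (ν₀c m2 g₀))
      atTop (𝓝 (-(1 / m2 ^ 2) * (cfn m2 g₀ * (gInf m2 g₀ / g₀) ^ (1 / 4 : ℝ)))) := by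
  obtain ⟨dμ, dw, dk, χ, M, hχ, hdw, hdk, hlim, hev⟩ := h.identity_deriv m2 hm2 g₀ hg₀
  set D₀ : ℝ := cfn m2 g₀ * (gInf m2 g₀ / g₀) ^ (1 / 4 : ℝ)
  have hdom : Tendsto (fun N => M * χ N * |dμ N / (L : ℝ) ^ (2 * N)|) atTop (𝓝 0) := by
    have := (hχ.const_mul M).mul ((continuous_abs.tendsto _).comp hlim)
    simpa using this
  have hsq : ∀ (u : ℕ → ℝ), (∀ N, |u N| ≤ M * χ N * |dμ N / (L : ℝ) ^ (2 * N)|) →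
      Tendsto u atTop (𝓝 0) := fun u hu =>
    squeeze_zero_norm (fun N => by rw [Real.norm_eq_abs]; exact hu N) hdom
  have hw0 := hsq dw hdw
  have hk0 := hsq dk hdk
  have hval : Tendsto (fun N => 1 / m2 ^ 2 * (-(dμ N / (L : ℝ) ^ (2 * N)) + dw N + dk N))
      atTop (𝓝 (-(1 / m2 ^ 2) * D₀)) := by
    have := ((hlim.neg.add hw0).add hk0).const_mul (1 / m2 ^ 2)
    simp only [add_zero] at this
    convert this using 2
    ring
  exact hval.congr' (hev.mono fun N hN => hN.deriv.symm)

/-- **`∂χ̂/∂ν₀ = -m⁻⁴c(m²,g₀)(ǧ_∞/g₀)^γ`** at `(m²,g₀,ν₀ᶜ,z₀ᶜ)`, `m², g₀ ∈ (0,δ)` (through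
`deriv_chiHat_eq_of_tendsto`: `∂χ̂/∂ν₀ = lim_N ∂χ̂_N/∂ν₀` above `ν_c`).
[cite: BauerschmidtBrydgesSlade2015LogCorr, §8.4 with §4.1 (∂χ/∂ν = (1+z₀)² lim_N ∂χ̂_N/∂ν₀)] -/
theorem deriv_chiHat_eq (hs : K * δ ≤ 1 / 2) {m2 : ℝ} (hm2 : m2 ∈ Ioo (0 : ℝ) δ) {g₀ : ℝ}
    (hg₀ : g₀ ∈ Ioo (0 : ℝ) δ) :
    deriv (fun ν₀ => chiHat 4 m2 g₀ ν₀ (z₀c m2 g₀)) (ν₀c m2 g₀) =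
      -(1 / m2 ^ 2) * (cfn m2 g₀ * (gInf m2 g₀ / g₀) ^ (1 / 4 : ℝ)) :=
  deriv_chiHat_eq_of_tendsto h.two_le hg₀.1.le m2 (ν₀c m2 g₀)
    (h.neg_one_lt_z₀c hs (Ioo_subset_Ico_self hm2) hg₀)
    (h.criticalNu_lt_and_chiHat_eq hs hm2 hg₀).1 (h.tendsto_deriv_chiHatN hm2 hg₀)

/-- `c ≥ ½` when `Kδ ≤ ½` (`|c - 1| ≤ Kg₀ ≤ Kδ ≤ ½`). [cite: BauerschmidtBrydgesSlade2015LogCorr, Lemma 8.3.3 (c = 1 + O(g₀))] -/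
theorem half_le_c (hs : K * δ ≤ 1 / 2) {m2 : ℝ} (hm2 : m2 ∈ Ico (0 : ℝ) δ) {g₀ : ℝ}
    (hg₀ : g₀ ∈ Ioo (0 : ℝ) δ) : 1 / 2 ≤ cfn m2 g₀ := by
  have h1 := h.c_sub_one m2 hm2 g₀ hg₀
  have h2 : K * g₀ ≤ K * δ := mul_le_mul_of_nonneg_left hg₀.2.le h.K_nonneg
  have := le_abs_self (cfn m2 g₀ - 1)
  have := neg_abs_le (cfn m2 g₀ - 1)
  linarith

/-- **The second display of Theorem 4.1**: `∂χ̂/∂ν₀ ∼ -m⁻⁴c(ĝ₀)/(ĝ₀𝖡_{m²})^γ` as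
`(m²,g₀) → (0,ĝ₀)` in `(0,δ)²`, with `c(ĝ₀) = c(0,ĝ₀)`: by `deriv_chiHat_eq` the ratio is
`(c(m²,g₀)/c(0,ĝ₀))·(ǧ_∞𝖡_{m²}·ĝ₀/g₀)^{1/4} → 1` (continuity of `c`, (e:ginfty), `g₀ → ĝ₀`).
[cite: BauerschmidtBrydgesSlade2015LogCorr, §8.4 and display (nupinf) ("setting c(ĝ₀) = c(0,ĝ₀), and by Lemma 8.3.2")] -/
theorem chiHat_deriv_asymp (hs : K * δ ≤ 1 / 2) {ĝ₀ : ℝ} (hĝ₀ : ĝ₀ ∈ Ioo (0 : ℝ) δ) :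
    Tendsto (fun p : ℝ × ℝ =>
        deriv (fun ν₀ => chiHat 4 p.1 p.2 ν₀ (z₀c p.1 p.2)) (ν₀c p.1 p.2) /
          (-(1 / p.1 ^ 2) * cfn 0 ĝ₀ / (ĝ₀ * freeBubble 4 p.1) ^ (1 / 4 : ℝ)))
      (𝓝[Ioo 0 δ ×ˢ Ioo 0 δ] (0, ĝ₀)) (𝓝 1) := by
  set S : Set (ℝ × ℝ) := Ioo 0 δ ×ˢ Ioo 0 δ
  set ĉ : ℝ := cfn 0 ĝ₀ with hĉdef
  have hĉpos : 0 < ĉ := lt_of_lt_of_le (by norm_num) (h.half_le_c hs ⟨le_rfl, h.pos⟩ hĝ₀)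
  have hĉne : ĉ ≠ 0 := hĉpos.ne'
  have hĝ₀ne : ĝ₀ ≠ 0 := hĝ₀.1.ne'
  -- the three limits
  have hc : Tendsto (fun p : ℝ × ℝ => cfn p.1 p.2) (𝓝[S] (0, ĝ₀)) (𝓝 ĉ) := by
    have h0 : ((0 : ℝ), ĝ₀) ∈ Ico 0 δ ×ˢ Ico 0 δ := ⟨⟨le_rfl, h.pos⟩, Ioo_subset_Ico_self hĝ₀⟩
    exact ((h.cont_c (0, ĝ₀) h0).mono
      (prod_mono Ioo_subset_Ico_self Ioo_subset_Ico_self)).tendsto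
  have hg : Tendsto (fun p : ℝ × ℝ => p.2) (𝓝[S] (0, ĝ₀)) (𝓝 ĝ₀) :=
    (continuous_snd.tendsto ((0 : ℝ), ĝ₀)).mono_left nhdsWithin_le_nhds
  have hGB := h.gInf_asymp ĝ₀ hĝ₀
  -- the model function and its limit
  have hG : Tendsto (fun p : ℝ × ℝ =>
      cfn p.1 p.2 / ĉ * ((gInf p.1 p.2 * freeBubble 4 p.1) * (ĝ₀ / p.2)) ^ (1 / 4 : ℝ))
      (𝓝[S] (0, ĝ₀)) (𝓝 1) := by
    have hq : Tendsto (fun p : ℝ × ℝ => ĝ₀ / p.2) (𝓝[S] (0, ĝ₀)) (𝓝 (ĝ₀ / ĝ₀)) :=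
      (tendsto_const_nhds : Tendsto (fun _ : ℝ × ℝ => ĝ₀) (𝓝[S] (0, ĝ₀)) (𝓝 ĝ₀)).div hg hĝ₀ne
    have := (hc.div_const ĉ).mul ((hGB.mul hq).rpow_const (p := (1 / 4 : ℝ)) (Or.inr (by norm_num)))
    rw [div_self hĉne, div_self hĝ₀ne, one_mul, one_mul, Real.one_rpow] at this
    exact this
  refine hG.congr' ?_
  have hev : ∀ᶠ p : ℝ × ℝ in 𝓝[S] (0, ĝ₀), 1 / 2 < gInf p.1 p.2 * freeBubble 4 p.1 :=
    hGB.eventually (lt_mem_nhds (by norm_num))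
  filter_upwards [self_mem_nhdsWithin, hev] with p hp hpB
  obtain ⟨m2, g₀⟩ := p
  obtain ⟨hm2, hg₀⟩ := hp
  simp only at hpB hm2 hg₀ ⊢
  have hB0 : 0 ≤ freeBubble 4 m2 := freeBubble_nonneg 4 m2
  have hBpos : 0 < freeBubble 4 m2 := by
    rcases hB0.lt_or_eq with hB | hB
    · exact hB
    · rw [← hB, mul_zero] at hpB; linarith
  have hGpos : 0 < gInf m2 g₀ := by
    by_contra hle
    push Not at hle
    have : gInf m2 g₀ * freeBubble 4 m2 ≤ 0 := mul_nonpos_of_nonpos_of_nonneg hle hB0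
    linarith
  have hq0 : 0 ≤ gInf m2 g₀ / g₀ := div_nonneg hGpos.le hg₀.1.le
  have hĝB0 : 0 ≤ ĝ₀ * freeBubble 4 m2 := mul_nonneg hĝ₀.1.le hB0
  have hY : 0 < (ĝ₀ * freeBubble 4 m2) ^ (1 / 4 : ℝ) :=
    Real.rpow_pos_of_pos (mul_pos hĝ₀.1 hBpos) _
  rw [h.deriv_chiHat_eq hs hm2 hg₀]
  have hXY : ((gInf m2 g₀ * freeBubble 4 m2) * (ĝ₀ / g₀)) ^ (1 / 4 : ℝ) =
      (gInf m2 g₀ / g₀) ^ (1 / 4 : ℝ) * (ĝ₀ * freeBubble 4 m2) ^ (1 / 4 : ℝ) := by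
    rw [show (gInf m2 g₀ * freeBubble 4 m2) * (ĝ₀ / g₀) = (gInf m2 g₀ / g₀) * (ĝ₀ * freeBubble 4 m2)
      by ring]
    exact Real.mul_rpow hq0 hĝB0
  rw [hXY]
  have hm2ne : m2 ≠ 0 := hm2.1.ne'
  field_simp

/-- **Theorem 4.1 from the §8.4 inputs** (for `δ` with `Kδ ≤ ½`), with `c(ĝ₀) = c(0,ĝ₀)`.
[cite: BauerschmidtBrydgesSlade2015LogCorr, §8.4 (Proof of Theorem 4.1)] -/
theorem thm41Data (hs : K * δ ≤ 1 / 2) : Thm41Data δ K ν₀c z₀c (fun g => cfn 0 g) where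
  pos := h.pos
  cont_ν₀c := h.cont_ν₀c
  cont_z₀c := h.cont_z₀c
  diff_ν₀c := h.diff_ν₀c
  diff_z₀c := h.diff_z₀c
  cont_c := by
    have hf : Continuous fun g : ℝ => ((0 : ℝ), g) := continuous_const.prodMk continuous_id
    exact h.cont_c.comp hf.continuousOn fun g hg => ⟨⟨le_rfl, h.pos⟩, Ioo_subset_Ico_self hg⟩
  c_sub_one := fun g₀ hg₀ => h.c_sub_one 0 ⟨le_rfl, h.pos⟩ g₀ hg₀
  chiHat_eq := fun m2 hm2 g₀ hg₀ => (h.criticalNu_lt_and_chiHat_eq hs hm2 hg₀).2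
  chiHat_deriv := fun ĝ₀ hĝ₀ => h.chiHat_deriv_asymp hs hĝ₀
  ν₀c_zero := h.ν₀c_zero
  z₀c_zero := h.z₀c_zero
  deriv_ν₀c := h.deriv_ν₀c
  deriv_z₀c := h.deriv_z₀c

end Sec84Data

/-- `BBS2015_thm41` (Theorem 4.1 as a named fact) from the §8.4 inputs: "let `δ > 0` be
sufficiently small" — the data are restricted to `δ' = min(δ, 1/(2K+2))`, where `Kδ' ≤ ½`.
[cite: BauerschmidtBrydgesSlade2015LogCorr, §8.4 (Proof of Theorem 4.1) and Theorem 4.1 ("δ sufficiently small")] -/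
theorem BBS2015_thm41_of_sec84Data {δ K : ℝ} {L : ℕ} {ν₀c z₀c cfn gInf : ℝ → ℝ → ℝ}
    (h : Sec84Data δ K L ν₀c z₀c cfn gInf) : BBS2015_thm41 := by
  have hK := h.K_nonneg
  have hK1 : 0 < 2 * K + 2 := by linarith
  set δ' : ℝ := min δ (1 / (2 * K + 2)) with hδ'
  have hδ'pos : 0 < δ' := lt_min h.pos (by positivity)
  have hδ'le : δ' ≤ δ := min_le_left _ _
  have hs : K * δ' ≤ 1 / 2 := by
    have h1 : δ' ≤ 1 / (2 * K + 2) := min_le_right _ _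
    have h2 : K * δ' ≤ K * (1 / (2 * K + 2)) := mul_le_mul_of_nonneg_left h1 hK
    have h3 : K * (1 / (2 * K + 2)) ≤ 1 / 2 := by
      rw [mul_one_div, div_le_iff₀ hK1]
      linarith
    linarith
  exact ⟨δ', K, ν₀c, z₀c, fun g => cfn 0 g, (h.restrict hδ'pos hδ'le).thm41Data hs⟩

/-- Theorem 1.1 (`BBS2015_thm11`) from the §8.4 inputs, through `BBS2015_thm41.thm11` (§4.3 with
Proposition 4.2(ii), Lemma 2.1 and (1.8), all proved in the tree).
[cite: BauerschmidtBrydgesSlade2015LogCorr, §8.4 and §4.3] -/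
theorem BBS2015_thm11_of_sec84Data {δ K : ℝ} {L : ℕ} {ν₀c z₀c cfn gInf : ℝ → ℝ → ℝ}
    (h : Sec84Data δ K L ν₀c z₀c cfn gInf) : BBS2015_thm11 :=
  (BBS2015_thm41_of_sec84Data h).thm11

end CTWSAW

end Literature.Barriers.CriticalPhenomena
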